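import Summits.Ventures.CertifiedQuantumChemistry.Rows.OrbitalRotationExactInvariance
import Summits.Ventures.CertifiedQuantumChemistry.Statement
import HarnessLib

/-!
# Ventures/CertifiedQuantumChemistry — Rows/OrbitalRotationRows.lean: the cell's certified QUANTITIES
# and ROW PREDICATES transport under orbital rotations of the model

HONEST FRAMING (verbatim): certified bounds for a stated model Hamiltonian in a stated basis; not a
claim about the real molecule beyond that model.

Seat rdm-B, ROWS courtesy file (theorems only; no `def`, no notation); the MODEL-level end of the
orbital-rotation set (`Rows/OrbitalRotationHamiltonian.lean`: `Γ(Ū)† Ĥ(h, g) Γ(Ū) = Ĥ(h', g')`;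
`Rows/OrbitalRotationExactInvariance.lean`: the exact energies are invariants). Two exact-rational
models `F F' : Model k` (`Statement.lean`) are related by an ORBITAL ROTATION when, read in `ℂ`, the
tables of `F'` are the rotated tables of `F` for some unitary `u` on `Fin k`:
`F'.h_{ab} = Σ_{pq} u_{pa} ū_{qb} F.h_{pq}`, `F'.eri_{abcd} = Σ_{pqrs} u_{pa} ū_{qb} u_{rc} ū_{sd} F.eri_{pqrs}`,
`F'.ecore = F.ecore` (hypotheses `hu`, `hh`, `hg`, `hc`; e.g. `u` a signed permutation, or the
`1/√2`-adapted pairs of an abelian point group, whose rotated tables are again rational). Then: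

* §1 `conjTranspose_Gamma_mul_spinPlus_mul_Gamma`, `commute_Gamma_mapStar_spinPlus`: the Bogoliubov
  lift of a spin-free rotation fixes `Ŝ_+` (`Γ(Ū)† Ŝ_+ Γ(Ū) = Ŝ_+`), so it preserves the SINGLET
  subspace `singletSector k n` (`Gamma_mapStar_mulVec_mem_singletSector`);
* §2 `exists_orbital_lift` (the spin-free lift `u ⊗ 1₂` written as a term),
  `Model.hamiltonian_eq_conj_orbital` (`Γ(Ū)† H_F Γ(Ū) = H_{F'}`),
  **`Model.exists_unitary_conj_of_conj_orbital`** (a Fock-space unitary preserving the `(N_α, N_β)`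
  sectors and commuting with `Ŝ_+` conjugates `H_F` into `H_{F'}`);
* §3 THE CERTIFIED QUANTITIES ARE EQUAL: **`Model.energy_conj_orbital`** (`F'.energy a b = F.energy a b`),
  `Model.groundEnergy_conj_orbital`, **`Model.singletEnergy_conj_orbital`**; hence THE ROW PREDICATES
  TRANSPORT: `lowerRow_iff_conj_orbital`, `upperRow_iff_conj_orbital`, `bracket_iff_conj_orbital`,
  `singletLowerRow_iff_conj_orbital`, `singletUpperRow_iff_conj_orbital`, `singletBracket_iff_conj_orbital`
  — a row certified for the model written in one orthonormal orbital basis of the active space IS the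
  same row of the model written in any rotated basis (no symmetry hypothesis `IsSymmetric` needed).

READING: statements about the ABSTRACT quantities `Model.energy`, `Model.singletEnergy` and the row
PREDICATES of two models related by hypothesis; NO row is derived here, nothing asserts a bound about
any deposited model, no certificate sentence / hint / claim node depends on this file. Everything is
PROVED (0 sorry, standard axioms); no definitions, no named facts.

References: T. Helgaker, P. Jørgensen, J. Olsen, *Molecular Electronic-Structure Theory* (Wiley 2000)
§3.2 (unitary orbital transformations); H. Tasaki, *Physics and Mathematics of Quantum Many-Body
Systems* (Springer 2020) §2.2 (variational characterisation in an invariant subspace).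

Tree (REUSED): `conjTranspose_Gamma_mul_molecularHamiltonian_mul_Gamma`, `create_orbital`,
`annihilate_orbital`, `star_mapStar_row`, `mapStar_mem_unitaryGroup`, `conjTranspose_Gamma_mul_Gamma`,
`Gamma_mul_conjTranspose_Gamma` (`Rows/OrbitalRotationHamiltonian`); `sectorGroundEnergy_conjTranspose_Gamma_mul`,
`groundEnergy_conjTranspose_Gamma_mul`, `mapStar_spin_sel_of_orbital` (`Rows/OrbitalRotationExactInvariance`);
`orbital_mul_conjTranspose` (`Rows/OrbitalRotationEnergy`); `conjTranspose_Gamma_mul_excitation_mul_Gamma`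
(`ColemanOneMatrixRepresentability`); `preservesSectors_Gamma(_conjTranspose)`
(`Summits/HubbardSuperconductivity/…/Theorems/WidthHaldaneFreeFloor`); `Matrix.minEnergyOn_conjTranspose_mul_mul`
(`QuantumLattice.MagneticHubbardTorusGauge`); `Model`, `Model.energy`, `Model.singletEnergy`, `singletSector`,
`LowerRow`, `UpperRow`, `Bracket`, `SingletLowerRow`, `SingletUpperRow`, `SingletBracket` (`Statement.lean`).
-/

noncomputable section

namespace Summit.Ventures.CertifiedQuantumChemistry

open Matrix Finset
open Literature.MathematicalPhysics.QuantumLattice Literature.MathematicalPhysics.QuantumLattice.RayleighBound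
  Literature.MathematicalPhysics.QuantumChemistry
open scoped ComplexOrder Kronecker

/-! ## §1 The lift of a spin-free rotation fixes `Ŝ_+` and preserves the singlet subspace -/

section SpinPlus

variable {Λ : Type*} [LinearOrder Λ] [Fintype Λ]

/-- **`Γ(Ū)† Ŝ_+ Γ(Ū) = Ŝ_+`** for the spin-free lift `U` of a unitary `u`: the rotated raising
operator is `Σ_{ab} (Σ_x u_{xa} ū_{xb}) a†_{a↑} a_{b↓} = Σ_a a†_{a↑} a_{a↓}` by `u† u = 1`
(Helgaker–Jørgensen–Olsen §2.3.4: singlet operators and spin-free rotations). -/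
theorem conjTranspose_Gamma_mul_spinPlus_mul_Gamma {U : Matrix (Orb Λ) (Orb Λ) ℂ} {u : Matrix Λ Λ ℂ}
    (hu : u * uᴴ = 1) (hUu : ∀ p q σ τ, U (orb p σ) (orb q τ) = if σ = τ then u p q else 0) :
    (Gamma (U.map star))ᴴ * spinPlus * Gamma (U.map star) =
      (spinPlus : Matrix (Finset (Orb Λ)) (Finset (Orb Λ)) ℂ) := by
  have hW := mapStar_mem_unitaryGroup (orbital_mul_conjTranspose hUu hu)
  have hu' : uᴴ * u = 1 := mul_eq_one_comm.mp hu
  have key : ∀ a b : Λ, ∑ x, u x a * star (u x b) = if a = b then 1 else 0 := by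
    intro a b
    have h := congrFun (congrFun hu' b) a
    rw [mul_apply, one_apply] at h
    calc ∑ x, u x a * star (u x b) = ∑ x, uᴴ b x * u x a :=
          Finset.sum_congr rfl fun x _ => by rw [conjTranspose_apply, mul_comm]
      _ = if b = a then 1 else 0 := h
      _ = if a = b then 1 else 0 := by
          by_cases hab : a = b
          · rw [if_pos hab, if_pos hab.symm]
          · rw [if_neg hab, if_neg (Ne.symm hab)]
  calc (Gamma (U.map star))ᴴ * spinPlus * Gamma (U.map star)
      = ∑ x : Λ, (Gamma (U.map star))ᴴ * (creation (orb x 0) * annihilation (orb x 1)) *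
          Gamma (U.map star) := by
        rw [spinPlus, Finset.mul_sum, Finset.sum_mul]
    _ = ∑ x : Λ, ∑ a, ∑ b, (u x a * star (u x b)) • (creation (orb a 0) * annihilation (orb b 1)) := by
        refine Finset.sum_congr rfl fun x _ => ?_
        rw [conjTranspose_Gamma_mul_excitation_mul_Gamma hW, star_mapStar_row, star_mapStar_row,
          create_orbital hUu, annihilate_orbital hUu, Finset.sum_mul_sum]
        refine Finset.sum_congr rfl fun a _ => Finset.sum_congr rfl fun b _ => ?_
        rw [Matrix.smul_mul, Matrix.mul_smul, smul_smul]
    _ = ∑ a, ∑ x : Λ, ∑ b, (u x a * star (u x b)) • (creation (orb a 0) * annihilation (orb b 1)) :=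
        Finset.sum_comm
    _ = ∑ a, ∑ b, ∑ x : Λ, (u x a * star (u x b)) • (creation (orb a 0) * annihilation (orb b 1)) :=
        Finset.sum_congr rfl fun _ _ => Finset.sum_comm
    _ = ∑ a, ∑ b, (if a = b then creation (orb a 0) * annihilation (orb b 1) else 0) := by
        refine Finset.sum_congr rfl fun a _ => Finset.sum_congr rfl fun b _ => ?_
        rw [← Finset.sum_smul, key, ite_smul, one_smul, zero_smul]
    _ = spinPlus := by
        simp only [Finset.sum_ite_eq, Finset.mem_univ, if_true, spinPlus]

/-- `Γ(Ū)` commutes with `Ŝ_+` (spin-free lift of a unitary). -/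
theorem commute_Gamma_mapStar_spinPlus {U : Matrix (Orb Λ) (Orb Λ) ℂ} {u : Matrix Λ Λ ℂ}
    (hu : u * uᴴ = 1) (hUu : ∀ p q σ τ, U (orb p σ) (orb q τ) = if σ = τ then u p q else 0) :
    Commute (Gamma (U.map star)) (spinPlus : Matrix (Finset (Orb Λ)) (Finset (Orb Λ)) ℂ) := by
  have key := conjTranspose_Gamma_mul_spinPlus_mul_Gamma hu hUu
  have h2 := Gamma_mul_conjTranspose_Gamma (mapStar_mem_unitaryGroup (orbital_mul_conjTranspose hUu hu))
  rw [Commute, SemiconjBy]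
  calc Gamma (U.map star) * spinPlus
      = Gamma (U.map star) * ((Gamma (U.map star))ᴴ * spinPlus * Gamma (U.map star)) := by rw [key]
    _ = spinPlus * Gamma (U.map star) := by
        rw [← Matrix.mul_assoc, ← Matrix.mul_assoc, h2, Matrix.one_mul]

/-- `Γ(Ū)†` commutes with `Ŝ_+` as well. -/
theorem commute_conjTranspose_Gamma_mapStar_spinPlus {U : Matrix (Orb Λ) (Orb Λ) ℂ} {u : Matrix Λ Λ ℂ}
    (hu : u * uᴴ = 1) (hUu : ∀ p q σ τ, U (orb p σ) (orb q τ) = if σ = τ then u p q else 0) :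
    Commute (Gamma (U.map star))ᴴ (spinPlus : Matrix (Finset (Orb Λ)) (Finset (Orb Λ)) ℂ) := by
  have key := conjTranspose_Gamma_mul_spinPlus_mul_Gamma hu hUu
  have h1 := conjTranspose_Gamma_mul_Gamma (mapStar_mem_unitaryGroup (orbital_mul_conjTranspose hUu hu))
  rw [Commute, SemiconjBy]
  calc (Gamma (U.map star))ᴴ * spinPlus
      = (Gamma (U.map star))ᴴ * spinPlus * (Gamma (U.map star) * (Gamma (U.map star))ᴴ) := by
        rw [Gamma_mul_conjTranspose_Gamma
          (mapStar_mem_unitaryGroup (orbital_mul_conjTranspose hUu hu)), Matrix.mul_one]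
    _ = spinPlus * (Gamma (U.map star))ᴴ := by
        rw [← Matrix.mul_assoc, key]

end SpinPlus

/-! ## §2 Models related by an orbital rotation: the conjugating unitary -/

section Models

variable {k : ℕ}

/-- The spin-free lift `u ⊗ 1₂` of a one-particle matrix, written as a term in the tree's
`Orb = Λ ×ₗ Fin 2` indexing (no definition is introduced). -/
theorem exists_orbital_lift {Λ : Type*} (u : Matrix Λ Λ ℂ) :
    ∃ U : Matrix (Orb Λ) (Orb Λ) ℂ, ∀ p q σ τ, U (orb p σ) (orb q τ) = if σ = τ then u p q else 0 :=
  ⟨Matrix.of fun i j => if (ofLex i).2 = (ofLex j).2 then u (ofLex i).1 (ofLex j).1 else 0,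
    fun _ _ _ _ => rfl⟩

/-- `Γ(Ū)` maps the singlet subspace `singletSector k n` (the `(n, n)` sector intersected with
`ker Ŝ_+`) into itself, and so does `Γ(Ū)†`. -/
theorem Gamma_mapStar_mulVec_mem_singletSector {U : Matrix (Orb (Fin k)) (Orb (Fin k)) ℂ}
    {u : Matrix (Fin k) (Fin k) ℂ} (hu : u * uᴴ = 1)
    (hUu : ∀ p q σ τ, U (orb p σ) (orb q τ) = if σ = τ then u p q else 0) {n : ℕ}
    {ψ : Fock (Orb (Fin k))} (hψ : ψ ∈ singletSector k n) :
    Gamma (U.map star) *ᵥ ψ ∈ singletSector k n ∧ (Gamma (U.map star))ᴴ *ᵥ ψ ∈ singletSector k n := by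
  have hW := mapStar_mem_unitaryGroup (orbital_mul_conjTranspose hUu hu)
  have hspin := mapStar_spin_sel_of_orbital hUu
  rw [mem_singletSector_iff, mem_szSector_iff_isInSector] at hψ
  obtain ⟨hsec, hker⟩ := hψ
  constructor
  · rw [mem_singletSector_iff, mem_szSector_iff_isInSector]
    refine ⟨(Summit.HubbardSuperconductivity.HubbardSuperconductivity.Theorems.WidthHaldane.preservesSectors_Gamma
      hW hspin).isInSector_mulVec hsec, ?_⟩
    rw [mulVec_mulVec, (commute_Gamma_mapStar_spinPlus hu hUu).symm.eq, ← mulVec_mulVec, hker,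
      mulVec_zero]
  · rw [mem_singletSector_iff, mem_szSector_iff_isInSector]
    refine ⟨(Summit.HubbardSuperconductivity.HubbardSuperconductivity.Theorems.WidthHaldane.preservesSectors_Gamma_conjTranspose
      hW hspin).isInSector_mulVec hsec, ?_⟩
    rw [mulVec_mulVec, (commute_conjTranspose_Gamma_mapStar_spinPlus hu hUu).symm.eq, ← mulVec_mulVec,
      hker, mulVec_zero]

/-- **`Γ(Ū)† H_F Γ(Ū) = H_{F'}`** for two models whose complexified tables are related by the orbital
rotation `u` (any spin-free lift `U` of `u` with `U U† = 1`). -/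
theorem Model.hamiltonian_eq_conj_orbital {F F' : Model k} {u : Matrix (Fin k) (Fin k) ℂ}
    (hh : ∀ a b, ((F'.h a b : ℚ) : ℂ) = ∑ p, ∑ q, u p a * star (u q b) * (F.h p q : ℂ))
    (hg : ∀ a b c d, ((F'.eri a b c d : ℚ) : ℂ) =
      ∑ p, ∑ q, ∑ r, ∑ s, u p a * star (u q b) * u r c * star (u s d) * (F.eri p q r s : ℂ))
    (hc : F'.ecore = F.ecore) {U : Matrix (Orb (Fin k)) (Orb (Fin k)) ℂ} (hU : U * Uᴴ = 1)
    (hUu : ∀ p q σ τ, U (orb p σ) (orb q τ) = if σ = τ then u p q else 0) :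
    (Gamma (U.map star))ᴴ * F.hamiltonian * Gamma (U.map star) = F'.hamiltonian := by
  have e := conjTranspose_Gamma_mul_molecularHamiltonian_mul_Gamma hU hUu (fun p q => (F.h p q : ℂ))
    (fun p q r s => (F.eri p q r s : ℂ)) (F.ecore : ℂ)
  rw [Model.hamiltonian, Model.hamiltonian, e, hc]
  congr 1
  · funext a b
    exact (hh a b).symm
  · funext a b c d
    exact (hg a b c d).symm

/-- **TWO MODELS RELATED BY AN ORBITAL ROTATION HAVE UNITARILY EQUIVALENT HAMILTONIANS**, the
conjugating Fock-space unitary preserving every `(N_α, N_β)` sector and commuting with `Ŝ_+`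
(it is `Γ(Ū)` for the spin-free lift of `u`). -/
theorem Model.exists_unitary_conj_of_conj_orbital {F F' : Model k} {u : Matrix (Fin k) (Fin k) ℂ}
    (hu : u * uᴴ = 1)
    (hh : ∀ a b, ((F'.h a b : ℚ) : ℂ) = ∑ p, ∑ q, u p a * star (u q b) * (F.h p q : ℂ))
    (hg : ∀ a b c d, ((F'.eri a b c d : ℚ) : ℂ) =
      ∑ p, ∑ q, ∑ r, ∑ s, u p a * star (u q b) * u r c * star (u s d) * (F.eri p q r s : ℂ))
    (hc : F'.ecore = F.ecore) :
    ∃ W : Matrix (Finset (Orb (Fin k))) (Finset (Orb (Fin k))) ℂ,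
      W * Wᴴ = 1 ∧ Wᴴ * W = 1 ∧ PreservesSectors W ∧ Commute W spinPlus ∧
        Wᴴ * F.hamiltonian * W = F'.hamiltonian := by
  obtain ⟨U, hUu⟩ := exists_orbital_lift u
  have hU : U * Uᴴ = 1 := orbital_mul_conjTranspose hUu hu
  have hW := mapStar_mem_unitaryGroup hU
  exact ⟨Gamma (U.map star), Gamma_mul_conjTranspose_Gamma hW, conjTranspose_Gamma_mul_Gamma hW,
    Summit.HubbardSuperconductivity.HubbardSuperconductivity.Theorems.WidthHaldane.preservesSectors_Gamma hW
      (mapStar_spin_sel_of_orbital hUu),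
    commute_Gamma_mapStar_spinPlus hu hUu, Model.hamiltonian_eq_conj_orbital hh hg hc hU hUu⟩

/-! ## §3 The certified quantities are equal; the row predicates transport -/

/-- **THE CERTIFIED QUANTITY IS AN ORBITAL-ROTATION INVARIANT**: `F'.energy a b = F.energy a b` for two
models related by an orbital rotation (every sector; no symmetry hypothesis on the tables). -/
theorem Model.energy_conj_orbital {F F' : Model k} {u : Matrix (Fin k) (Fin k) ℂ} (hu : u * uᴴ = 1)
    (hh : ∀ a b, ((F'.h a b : ℚ) : ℂ) = ∑ p, ∑ q, u p a * star (u q b) * (F.h p q : ℂ))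
    (hg : ∀ a b c d, ((F'.eri a b c d : ℚ) : ℂ) =
      ∑ p, ∑ q, ∑ r, ∑ s, u p a * star (u q b) * u r c * star (u s d) * (F.eri p q r s : ℂ))
    (hc : F'.ecore = F.ecore) (a b : ℕ) : F'.energy a b = F.energy a b := by
  obtain ⟨U, hUu⟩ := exists_orbital_lift u
  have hU : U * Uᴴ = 1 := orbital_mul_conjTranspose hUu hu
  unfold Model.energy
  rw [← Model.hamiltonian_eq_conj_orbital hh hg hc hU hUu]
  exact sectorGroundEnergy_conjTranspose_Gamma_mul (mapStar_mem_unitaryGroup hU)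
    (mapStar_spin_sel_of_orbital hUu) _ a b

/-- The `N`-electron ground-state energies of two models related by an orbital rotation agree. -/
theorem Model.groundEnergy_conj_orbital {F F' : Model k} {u : Matrix (Fin k) (Fin k) ℂ} (hu : u * uᴴ = 1)
    (hh : ∀ a b, ((F'.h a b : ℚ) : ℂ) = ∑ p, ∑ q, u p a * star (u q b) * (F.h p q : ℂ))
    (hg : ∀ a b c d, ((F'.eri a b c d : ℚ) : ℂ) =
      ∑ p, ∑ q, ∑ r, ∑ s, u p a * star (u q b) * u r c * star (u s d) * (F.eri p q r s : ℂ))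
    (hc : F'.ecore = F.ecore) (N : ℕ) :
    Literature.MathematicalPhysics.QuantumLattice.groundEnergy F'.hamiltonian N =
      Literature.MathematicalPhysics.QuantumLattice.groundEnergy F.hamiltonian N := by
  obtain ⟨U, hUu⟩ := exists_orbital_lift u
  have hU : U * Uᴴ = 1 := orbital_mul_conjTranspose hUu hu
  rw [← Model.hamiltonian_eq_conj_orbital hh hg hc hU hUu]
  exact groundEnergy_conjTranspose_Gamma_mul (mapStar_mem_unitaryGroup hU) _ N

/-- **THE SINGLET QUANTITY IS AN ORBITAL-ROTATION INVARIANT**: `F'.singletEnergy n = F.singletEnergy n`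
(`Γ(Ū)` preserves the `(n, n)` sector and commutes with `Ŝ_+`, hence preserves `singletSector k n`). -/
theorem Model.singletEnergy_conj_orbital {F F' : Model k} {u : Matrix (Fin k) (Fin k) ℂ}
    (hu : u * uᴴ = 1)
    (hh : ∀ a b, ((F'.h a b : ℚ) : ℂ) = ∑ p, ∑ q, u p a * star (u q b) * (F.h p q : ℂ))
    (hg : ∀ a b c d, ((F'.eri a b c d : ℚ) : ℂ) =
      ∑ p, ∑ q, ∑ r, ∑ s, u p a * star (u q b) * u r c * star (u s d) * (F.eri p q r s : ℂ))
    (hc : F'.ecore = F.ecore) (n : ℕ) : F'.singletEnergy n = F.singletEnergy n := by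
  obtain ⟨U, hUu⟩ := exists_orbital_lift u
  have hU : U * Uᴴ = 1 := orbital_mul_conjTranspose hUu hu
  have hW := mapStar_mem_unitaryGroup hU
  unfold Model.singletEnergy
  rw [← Model.hamiltonian_eq_conj_orbital hh hg hc hU hUu]
  exact Matrix.minEnergyOn_conjTranspose_mul_mul F.hamiltonian (Gamma (U.map star)) _
    (conjTranspose_Gamma_mul_Gamma hW) (Gamma_mul_conjTranspose_Gamma hW)
    (fun ψ hψ => (Gamma_mapStar_mulVec_mem_singletSector hu hUu hψ).1)
    (fun ψ hψ => (Gamma_mapStar_mulVec_mem_singletSector hu hUu hψ).2)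

/-- **LOWER ROWS TRANSPORT under orbital rotations of the model.** -/
theorem lowerRow_iff_conj_orbital {F F' : Model k} {u : Matrix (Fin k) (Fin k) ℂ} (hu : u * uᴴ = 1)
    (hh : ∀ a b, ((F'.h a b : ℚ) : ℂ) = ∑ p, ∑ q, u p a * star (u q b) * (F.h p q : ℂ))
    (hg : ∀ a b c d, ((F'.eri a b c d : ℚ) : ℂ) =
      ∑ p, ∑ q, ∑ r, ∑ s, u p a * star (u q b) * u r c * star (u s d) * (F.eri p q r s : ℂ))
    (hc : F'.ecore = F.ecore) (a b : ℕ) (lo : ℚ) : LowerRow F' a b lo ↔ LowerRow F a b lo := by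
  unfold LowerRow
  rw [Model.energy_conj_orbital hu hh hg hc]

/-- **UPPER ROWS TRANSPORT under orbital rotations of the model.** -/
theorem upperRow_iff_conj_orbital {F F' : Model k} {u : Matrix (Fin k) (Fin k) ℂ} (hu : u * uᴴ = 1)
    (hh : ∀ a b, ((F'.h a b : ℚ) : ℂ) = ∑ p, ∑ q, u p a * star (u q b) * (F.h p q : ℂ))
    (hg : ∀ a b c d, ((F'.eri a b c d : ℚ) : ℂ) =
      ∑ p, ∑ q, ∑ r, ∑ s, u p a * star (u q b) * u r c * star (u s d) * (F.eri p q r s : ℂ))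
    (hc : F'.ecore = F.ecore) (a b : ℕ) (hi : ℚ) : UpperRow F' a b hi ↔ UpperRow F a b hi := by
  unfold UpperRow
  rw [Model.energy_conj_orbital hu hh hg hc]

/-- **BRACKETS TRANSPORT under orbital rotations of the model.** -/
theorem bracket_iff_conj_orbital {F F' : Model k} {u : Matrix (Fin k) (Fin k) ℂ} (hu : u * uᴴ = 1)
    (hh : ∀ a b, ((F'.h a b : ℚ) : ℂ) = ∑ p, ∑ q, u p a * star (u q b) * (F.h p q : ℂ))
    (hg : ∀ a b c d, ((F'.eri a b c d : ℚ) : ℂ) =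
      ∑ p, ∑ q, ∑ r, ∑ s, u p a * star (u q b) * u r c * star (u s d) * (F.eri p q r s : ℂ))
    (hc : F'.ecore = F.ecore) (a b : ℕ) (lo hi : ℚ) :
    Bracket F' a b lo hi ↔ Bracket F a b lo hi := by
  unfold Bracket
  rw [lowerRow_iff_conj_orbital hu hh hg hc, upperRow_iff_conj_orbital hu hh hg hc]

/-- **SINGLET LOWER ROWS TRANSPORT under orbital rotations of the model.** -/
theorem singletLowerRow_iff_conj_orbital {F F' : Model k} {u : Matrix (Fin k) (Fin k) ℂ}
    (hu : u * uᴴ = 1)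
    (hh : ∀ a b, ((F'.h a b : ℚ) : ℂ) = ∑ p, ∑ q, u p a * star (u q b) * (F.h p q : ℂ))
    (hg : ∀ a b c d, ((F'.eri a b c d : ℚ) : ℂ) =
      ∑ p, ∑ q, ∑ r, ∑ s, u p a * star (u q b) * u r c * star (u s d) * (F.eri p q r s : ℂ))
    (hc : F'.ecore = F.ecore) (n : ℕ) (lo : ℚ) :
    SingletLowerRow F' n lo ↔ SingletLowerRow F n lo := by
  unfold SingletLowerRow
  rw [Model.singletEnergy_conj_orbital hu hh hg hc]

/-- **SINGLET UPPER ROWS TRANSPORT under orbital rotations of the model.** -/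
theorem singletUpperRow_iff_conj_orbital {F F' : Model k} {u : Matrix (Fin k) (Fin k) ℂ}
    (hu : u * uᴴ = 1)
    (hh : ∀ a b, ((F'.h a b : ℚ) : ℂ) = ∑ p, ∑ q, u p a * star (u q b) * (F.h p q : ℂ))
    (hg : ∀ a b c d, ((F'.eri a b c d : ℚ) : ℂ) =
      ∑ p, ∑ q, ∑ r, ∑ s, u p a * star (u q b) * u r c * star (u s d) * (F.eri p q r s : ℂ))
    (hc : F'.ecore = F.ecore) (n : ℕ) (hi : ℚ) :
    SingletUpperRow F' n hi ↔ SingletUpperRow F n hi := by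
  unfold SingletUpperRow
  rw [Model.singletEnergy_conj_orbital hu hh hg hc]

/-- **SINGLET BRACKETS TRANSPORT under orbital rotations of the model.** -/
theorem singletBracket_iff_conj_orbital {F F' : Model k} {u : Matrix (Fin k) (Fin k) ℂ}
    (hu : u * uᴴ = 1)
    (hh : ∀ a b, ((F'.h a b : ℚ) : ℂ) = ∑ p, ∑ q, u p a * star (u q b) * (F.h p q : ℂ))
    (hg : ∀ a b c d, ((F'.eri a b c d : ℚ) : ℂ) =
      ∑ p, ∑ q, ∑ r, ∑ s, u p a * star (u q b) * u r c * star (u s d) * (F.eri p q r s : ℂ))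
    (hc : F'.ecore = F.ecore) (n : ℕ) (lo hi : ℚ) :
    SingletBracket F' n lo hi ↔ SingletBracket F n lo hi := by
  unfold SingletBracket
  rw [singletLowerRow_iff_conj_orbital hu hh hg hc, singletUpperRow_iff_conj_orbital hu hh hg hc]

end Models

end Summit.Ventures.CertifiedQuantumChemistry

end
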